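import Mathlib.Combinatorics.SetFamily.HarrisKleitman
import Mathlib.Combinatorics.Hall.Basic
import HarnessLib
import HarnessLib.Audit

/-!
# `NoHeavyLowerTail` (crux stmt-CriticalPhenomena-4575), abstract sunflower cubic: the DISJOINT-DERANGEMENT LEMMA for down-sets
# (level 2 of the interval-Hall routing of decided-spectator demands; prim-l12-p2 gen 29)

Support file (`--supports stmt-CriticalPhenomena-4575`).  Pure finite-set combinatorics; no `sorry`, no new definitions.
Memo: run/shared/lean/prim/prim-l12/prim-l12-p2/FINDING-g29-RECTANGLE-REDUCTION.md §4.4.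

**Lemma (`exists_injective_disjoint_of_isLowerSet`).**  Every down-set `D` of finsets (an abstract simplicial complex, faces of any
ground type) admits an injective self-map `π : D → D` with `π Y` disjoint from `Y` for every `Y ∈ D`.

*Proof.*  Hall's theorem for the bipartite graph `Y ~ T ⟺ Disjoint Y T` on `D × D`.  For a set `s` of faces let `U` be the up-closure
of `s` in `Finset α`; the faces disjoint from some member of `s` are exactly `D ∩ {G : Gᶜ ∈ U}`, and `{G : Gᶜ ∈ U}` is a down-set of the
same size as `U`.  By the Harris–Kleitman inequality twice (an upper and a lower set anticorrelate; two lower sets correlate),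
`2^n · #(U ∩ D) ≤ #U · #D ≤ 2^n · #({G : Gᶜ ∈ U} ∩ D)`, and `s ⊆ U ∩ D`.  ∎

USE (memo §4.4, THEOREM A there): together with prim-ineq-gen-3's oriented antipodal Hall theorem
(`OrientedAntipodalHall.exists_injective_good_above_transitiveTournament`) it proves that in every `MSunflower` the bad partitions WITH A
DECIDED BLOCK `X` admit an injective assignment to slots `(K; S; T)` with `T ⊆ X ⊆ T ∪ S` and `K` of the colour of `X` (white points: the
Gladkov goods of the cube `E ∖ X` re-read with `T = X`; black points: `K :=` the oriented good of `E ∖ X` above the earlier half, then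
`T := π (E ∖ K ∖ X)` in the down-set of white parts of the goods of the cube `E ∖ K`) — the decided-spectator half of the interval Hall
conjecture (INT∀); the rainbow half remains open.
-/

namespace Summit.CriticalPhenomena.PercolationContinuityZ3.Theorems.SunflowerPartition

open Finset

variable {α : Type*} [DecidableEq α] [Fintype α]

/-- Hall's condition for the disjointness graph on a down-set: for every finite set `s` of faces, at least `#s` faces are disjoint from
some member of `s` (Harris–Kleitman twice). [this work] -/
theorem card_le_card_filter_disjoint_of_isLowerSet (D : Finset (Finset α)) (hD : IsLowerSet (D : Set (Finset α)))
    (s : Finset (Finset α)) (hs : s ⊆ D) :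
    #s ≤ #(D.filter fun G => ∃ F ∈ s, Disjoint F G) := by
  classical
  -- the up-closure of `s`
  set U : Finset (Finset α) := univ.filter fun G => ∃ F ∈ s, F ⊆ G with hU
  have hUup : IsUpperSet (U : Set (Finset α)) := by
    intro G G' hGG' hG
    rw [mem_coe, hU, mem_filter] at hG ⊢
    obtain ⟨-, F, hF, hFG⟩ := hG
    exact ⟨mem_univ _, F, hF, hFG.trans hGG'⟩
  -- the complemented copy of `U` (a down-set of the same size)
  set C : Finset (Finset α) := U.map ⟨compl, compl_injective⟩ with hC
  have hCmem : ∀ G, G ∈ C ↔ Gᶜ ∈ U := by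
    intro G
    rw [hC, mem_map]
    constructor
    · rintro ⟨G', hG', rfl⟩
      simpa using hG'
    · intro h
      exact ⟨Gᶜ, h, by simp⟩
  have hClow : IsLowerSet (C : Set (Finset α)) := by
    intro G G' hGG' hG
    rw [mem_coe, hCmem] at hG ⊢
    exact hUup (compl_subset_compl.2 hGG') hG
  have hcardC : #C = #U := by rw [hC, card_map]
  -- `s ⊆ U ∩ D`
  have h1 : #s ≤ #(U ∩ D) := by
    apply card_le_card
    intro F hF
    rw [mem_inter]
    refine ⟨?_, hs hF⟩
    rw [hU, mem_filter]
    exact ⟨mem_univ _, F, hF, Subset.rfl⟩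
  -- the faces disjoint from some member of `s` are `C ∩ D`
  have h2 : C ∩ D ⊆ D.filter fun G => ∃ F ∈ s, Disjoint F G := by
    intro G hG
    rw [mem_inter, hCmem, hU, mem_filter] at hG
    obtain ⟨⟨-, F, hF, hFG⟩, hGD⟩ := hG
    rw [mem_filter]
    refine ⟨hGD, F, hF, ?_⟩
    rw [Finset.disjoint_left]
    intro a haF haG
    have := hFG haF
    rw [mem_compl] at this
    exact this haG
  -- Harris–Kleitman twice
  have hk1 := hUup.card_inter_le_finset hD      -- 2^n * #(U ∩ D) ≤ #U * #D
  have hk2 := hClow.le_card_inter_finset hD      -- #C * #D ≤ 2^n * #(C ∩ D)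
  rw [hcardC] at hk2
  have h3 : 2 ^ Fintype.card α * #(U ∩ D) ≤ 2 ^ Fintype.card α * #(C ∩ D) := hk1.trans hk2
  have h4 : #(U ∩ D) ≤ #(C ∩ D) := Nat.le_of_mul_le_mul_left h3 (Nat.two_pow_pos _)
  exact h1.trans (h4.trans (card_le_card h2))

/-- **Disjoint-derangement lemma.**  Every down-set of finsets admits an injective self-map moving each face to a DISJOINT face. [this work] -/
theorem exists_injective_disjoint_of_isLowerSet (D : Finset (Finset α)) (hD : IsLowerSet (D : Set (Finset α))) :
    ∃ π : ↥D → ↥D, Function.Injective π ∧ ∀ Y : ↥D, Disjoint ((π Y : ↥D) : Finset α) (Y : Finset α) := by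
  classical
  -- Hall's marriage theorem for `t Y = {G ∈ D | Disjoint Y G}`
  let t : ↥D → Finset (Finset α) := fun Y => D.filter fun G => Disjoint (Y : Finset α) G
  have hall : ∀ s : Finset ↥D, #s ≤ #(s.biUnion t) := by
    intro s
    have hsub : s.image (fun Y : ↥D => (Y : Finset α)) ⊆ D := by
      intro F hF
      rw [mem_image] at hF
      obtain ⟨Y, -, rfl⟩ := hF
      exact Y.2
    have hc : #s = #(s.image fun Y : ↥D => (Y : Finset α)) :=
      (card_image_of_injective s Subtype.val_injective).symm
    rw [hc]
    refine (card_le_card_filter_disjoint_of_isLowerSet D hD _ hsub).trans (card_le_card ?_)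
    intro G hG
    rw [mem_filter] at hG
    obtain ⟨hGD, F, hF, hFG⟩ := hG
    rw [mem_image] at hF
    obtain ⟨Y, hYs, rfl⟩ := hF
    rw [mem_biUnion]
    exact ⟨Y, hYs, mem_filter.2 ⟨hGD, hFG⟩⟩
  obtain ⟨f, hf, hft⟩ := (Finset.all_card_le_biUnion_card_iff_exists_injective t).1 hall
  refine ⟨fun Y => ⟨f Y, (mem_filter.1 (hft Y)).1⟩, ?_, ?_⟩
  · intro Y₁ Y₂ h
    exact hf (by simpa using congrArg Subtype.val h)
  · intro Y
    exact ((mem_filter.1 (hft Y)).2).symm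

end Summit.CriticalPhenomena.PercolationContinuityZ3.Theorems.SunflowerPartition
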